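import Summits.CriticalPhenomena.PercolationContinuityZ3.Theorems.FK.InfiniteVolumeDLRClusters
import Literature.Probability.Process.BackwardCondExpConvergence
import Literature.Probability.LatticeModels.GibbsTailConditioning
import Literature.Probability.LatticeModels.RandomClusterShiftedBoxes
import Literature.Probability.LatticeModels.ThermodynamicLimit
import Mathlib.MeasureTheory.Integral.DominatedConvergence
import HarnessLib

/-!
# FK-continuity transplant, FO-06/FO-10 (infinite-volume structure): Lévy's downward theorem along the outside
# σ-algebras `𝒯_Λ` of growing regions, for a TAIL-TRIVIAL measure carried by lattice configurations

Registered R87 (cell INBOX l.6278, 2026-08-24); registry row FO-10b-g408; label DPA-B (coordinator fk-4 g192).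
Cell `fk-continuity` (bschramm), FO-10b lineage; support file for the FK-continuity transplant
(`--supports stmt-CriticalPhenomena-4575`); builds on p205010 (kernel theorem, internal audit signed; external expert
review pending). No named facts, no definitions, no sorries, standard axioms. Banked infinite-volume structure; not an
END-STATE dependency of the cell (not consumed by `_r3`); it says nothing about FH / TP_FK or continuity at `p_c`.

The measure-theoretic input of Grimmett 2006, Prop. (4.37)(c) ("by the bounded convergence theorem and the backward
martingale convergence theorem ... if `φ` is tail-trivial, `φ(X | 𝒯) = φ(X)`"), in the tree's vocabulary.  The outside
σ-algebras `𝒯_Λ = outsideEvents d Λ` (`InfiniteVolumeDLRDefs.lean`) of growing regions `Λ_n` decrease, but their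
intersection is LARGER than the tail σ-algebra `tailEvents (Sym2 (Site d)) Prop` of the configuration space
`Set (Sym2 (Site d))` (it still sees the non-lattice pairs, which lie off every `E_Λ`); for a measure carried by lattice
configurations this difference is invisible:

* `condExp_ae_eq_integral_of_forall_measure_eq_zero_or_one` — `μ[f | m] = μ(f)` a.s. when `μ` is `0/1`-valued on `m`;
* `exists_strictMono_tendsto_integral_abs_condExp_sub_of_forall_measure_eq_zero_or_one` — Lévy's downward theorem in
  `L¹` along a subsequence for a decreasing sequence of σ-algebras on whose intersection `μ` is `0/1`-valued (from the
  tree's `Process.exists_strictMono_ae_tendsto_condExp_antitone`, Durrett 2019 Thm. 4.7.3, and dominated convergence);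
* `measurableSet_tailEvents_preimage_inter`, `measure_eq_zero_or_one_of_isTailTrivial_of_ae_subset` — for `μ` carried by
  configurations inside `L` and tail-trivial, every event lying in `𝓕_{(F_n)ᶜ}` for a sequence `F_n` swallowing
  `Δ ∩ L` for every finite `Δ` has probability `0` or `1` (pull back by `ω ↦ ω ∩ L`, a tail event);
* **`exists_strictMono_tendsto_integral_abs_condExp_outsideEvents_sub_of_isTailTrivial`** — for a tail-trivial
  probability measure `P` on bond configurations of `ℤ^d` carried by lattice configurations, regions `Λ_n ⊇ Λ_n^{box}`
  increasing, and a bounded integrable `f`: along a subsequence, `∫ |P[f | 𝒯_{Λ_n}] - P(f)| dP → 0`.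

## References

* G. Grimmett, *The Random-Cluster Model*, Springer 2006: Prop. (4.37)(c) and its proof, pp. 82–83, 86–87.
  [Grimmett2006]
* R. Durrett, *Probability: Theory and Examples*, 5th ed., CUP 2019, Thm. 4.7.3 (Lévy's downward theorem). [Durrett2019]
* H.-O. Georgii, *Gibbs Measures and Phase Transitions*, 2nd ed. 2011, Prop. 7.9 (tail triviality and conditional
  expectations). [Georgii2011]
-/

noncomputable section

open MeasureTheory Filter Set
open scoped Topology ENNReal

namespace Summit.CriticalPhenomena.PercolationContinuityZ3.Theorems.FK

open Literature.Probability.Percolation Literature.Probability.LatticeModels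

/-! ### Conditional expectations given a σ-algebra on which the measure is `0/1`-valued -/

section Trivial

variable {Ω : Type*} {m m0 : MeasurableSpace Ω} {μ : Measure[m0] Ω}

/-- If `μ` takes only the values `0` and `1` on the sub-σ-algebra `m`, then `μ[f | m] = μ(f)` a.s. (both sides have
the same integrals over `m`-sets). (Georgii 2011, Prop. 7.9 / Thm. 7.7, the step `μ(A | 𝒯) = μ(A)`.)
[cite: Georgii2011, Prop. 7.9] -/
theorem condExp_ae_eq_integral_of_forall_measure_eq_zero_or_one [IsProbabilityMeasure μ] (hm : m ≤ m0)
    (htriv : ∀ s, MeasurableSet[m] s → μ s = 0 ∨ μ s = 1) {f : Ω → ℝ} (hf : Integrable f μ) :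
    μ[f|m] =ᵐ[μ] fun _ => ∫ x, f x ∂μ := by
  refine (ae_eq_condExp_of_forall_setIntegral_eq hm hf (fun s _ _ => (integrable_const _).integrableOn)
    (fun s hs _ => ?_) (stronglyMeasurable_const.aestronglyMeasurable)).symm
  have hsm : MeasurableSet s := hm _ hs
  rcases htriv s hs with h0 | h1
  · rw [setIntegral_const, Measure.restrict_eq_zero.2 h0]
    simp [measureReal_def, h0]
  · have hsc : μ sᶜ = 0 := (prob_compl_eq_zero_iff hsm).2 h1
    have hres : μ.restrict s = μ := Measure.restrict_eq_self_of_ae_mem (ae_iff.2 hsc)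
    rw [hres, integral_const, smul_eq_mul, measureReal_def, measure_univ, ENNReal.toReal_one, one_mul]

variable [IsProbabilityMeasure μ] {ℱ : ℕ → MeasurableSpace Ω} {f : Ω → ℝ} {C : ℝ}

/-- **Lévy's downward theorem in `L¹` along a subsequence, for a `0/1`-valued limit σ-algebra** (Durrett 2019,
Thm. 4.7.3 with the identification of the limit): for a decreasing sequence of σ-algebras `ℱ n` on whose intersection
`μ` takes only the values `0, 1`, and a bounded integrable `f`, along some subsequence
`∫ |μ[f | ℱ n] - μ(f)| dμ → 0`. [cite: Durrett2019, Thm. 4.7.3] -/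
theorem exists_strictMono_tendsto_integral_abs_condExp_sub_of_forall_measure_eq_zero_or_one (hanti : Antitone ℱ)
    (hle : ∀ n, ℱ n ≤ m0) (htriv : ∀ s, MeasurableSet[⨅ n, ℱ n] s → μ s = 0 ∨ μ s = 1) (hf : Integrable f μ)
    (hfC : ∀ x, |f x| ≤ C) :
    ∃ φ : ℕ → ℕ, StrictMono φ ∧
      Tendsto (fun j => ∫ x, |(μ[f|ℱ (φ j)]) x - ∫ y, f y ∂μ| ∂μ) atTop (𝓝 0) := by
  have hfC' : ∀ᵐ x ∂μ, |f x| ≤ C := Eventually.of_forall hfC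
  obtain ⟨φ, hφ, hae⟩ :=
    Literature.Probability.Process.exists_strictMono_ae_tendsto_condExp_antitone hanti hle hf hfC'
  refine ⟨φ, hφ, ?_⟩
  have hlim : μ[f|⨅ n, ℱ n] =ᵐ[μ] fun _ => ∫ y, f y ∂μ :=
    condExp_ae_eq_integral_of_forall_measure_eq_zero_or_one (le_trans (iInf_le ℱ 0) (hle 0)) htriv hf
  set c : ℝ := ∫ y, f y ∂μ with hc
  set F : ℕ → Ω → ℝ := fun j x => |(μ[f|ℱ (φ j)]) x - c| with hF
  have hFmeas : ∀ j, AEStronglyMeasurable (F j) μ := fun j => by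
    have h1 : AEStronglyMeasurable (μ[f|ℱ (φ j)]) μ :=
      (stronglyMeasurable_condExp.mono (hle _)).aestronglyMeasurable
    exact continuous_abs.comp_aestronglyMeasurable (h1.sub aestronglyMeasurable_const)
  have hFbound : ∀ j, ∀ᵐ x ∂μ, ‖F j x‖ ≤ C + |c| := fun j => by
    filter_upwards [ae_bdd_abs_condExp_of_ae_bdd_abs (m := ℱ (φ j)) hfC'] with x hx
    rw [hF, Real.norm_eq_abs, abs_abs]
    exact (abs_sub _ _).trans (add_le_add hx le_rfl)
  have hFlim : ∀ᵐ x ∂μ, Tendsto (fun j => F j x) atTop (𝓝 0) := by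
    filter_upwards [hae, hlim] with x hx hxlim
    rw [hxlim] at hx
    have h := (hx.sub_const c).abs
    rwa [sub_self, abs_zero] at h
  have h := tendsto_integral_of_dominated_convergence (fun _ => C + |c|) hFmeas
    (integrable_const _) hFbound hFlim
  simpa [hF] using h

end Trivial

/-! ### Measures carried by configurations inside `L`: events off growing sets are tail events up to null sets -/

section Carried

variable {ι : Type*}

/-- Let `F_n ⊆ ι` swallow `Δ ∩ L` for every finite `Δ`, and let `B` lie in `𝓕_{(F_n)ᶜ}` for every `n`.  Then the
pull-back of `B` under `ω ↦ ω ∩ L` is a TAIL event: given a finite `Δ`, choose `n` with `Δ ∩ L ⊆ F_n`; the map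
`ω ↦ ω ∩ L` is measurable from `𝓕_{Δᶜ}` to `𝓕_{(F_n)ᶜ}` (a coordinate `a ∉ F_n` of `ω ∩ L` is the coordinate `a` of
`ω` if `a ∈ L` — and then `a ∉ Δ` — and is constant otherwise). [folklore] -/
theorem measurableSet_tailEvents_preimage_inter {L : Set ι} {F : ℕ → Set ι}
    (hF : ∀ Δ : Finset ι, ∃ n, (↑Δ : Set ι) ∩ L ⊆ F n) {B : Set (Set ι)}
    (hB : ∀ n, MeasurableSet[cylinderEvents (X := fun _ : ι => Prop) (F n)ᶜ] B) :
    MeasurableSet[tailEvents ι Prop] ((fun ω : Set ι => ω ∩ L) ⁻¹' B) := by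
  classical
  rw [measurableSet_tailEvents_iff]
  intro Δ
  obtain ⟨n, hn⟩ := hF Δ
  have hg : @Measurable (ι → Prop) (ι → Prop) (cylinderEvents (X := fun _ : ι => Prop) (↑Δ : Set ι)ᶜ)
      (cylinderEvents (X := fun _ : ι => Prop) (F n)ᶜ) (fun ω a => ω a ∧ a ∈ L) := by
    rw [measurable_cylinderEvents_iff]
    intro a ha
    by_cases haL : a ∈ L
    · have haΔ : a ∈ (↑Δ : Set ι)ᶜ := fun h => ha (hn ⟨h, haL⟩)
      have : (fun ω : ι → Prop => ω a ∧ a ∈ L) = fun ω : ι → Prop => ω a := by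
        funext ω
        exact propext ⟨fun h => h.1, fun h => ⟨h, haL⟩⟩
      rw [this]
      exact measurable_cylinderEvent_apply (X := fun _ : ι => Prop) haΔ
    · have : (fun ω : ι → Prop => ω a ∧ a ∈ L) = fun _ => False := by
        funext ω
        exact propext ⟨fun h => haL h.2, False.elim⟩
      rw [this]
      exact measurable_const
  exact hg (hB n)

/-- **Tail triviality for a carried measure, read off growing sets**: if `μ` is carried by configurations inside `L`
and is tail-trivial, `F_n` swallows `Δ ∩ L` for every finite `Δ`, and `B` lies in `𝓕_{(F_n)ᶜ}` for every `n`, then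
`μ(B) ∈ {0, 1}` (`B` and its pull-back under `ω ↦ ω ∩ L` differ by a null set). [folklore] -/
theorem measure_eq_zero_or_one_of_isTailTrivial_of_ae_subset {μ : Measure (Set ι)}
    (hμ : IsTailTrivial (V := ι) (S := Prop) μ) {L : Set ι} (hL : ∀ᵐ ω ∂μ, ω ⊆ L) {F : ℕ → Set ι}
    (hF : ∀ Δ : Finset ι, ∃ n, (↑Δ : Set ι) ∩ L ⊆ F n) {B : Set (Set ι)}
    (hB : ∀ n, MeasurableSet[cylinderEvents (X := fun _ : ι => Prop) (F n)ᶜ] B) : μ B = 0 ∨ μ B = 1 := by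
  have hBt := measurableSet_tailEvents_preimage_inter hF hB
  have hae : ((fun ω : Set ι => ω ∩ L) ⁻¹' B : Set (Set ι)) =ᵐ[μ] B := by
    filter_upwards [hL] with ω hω
    have hωL : ω ∩ L = ω := Set.inter_eq_left.2 hω
    show (ω ∩ L ∈ B) = (ω ∈ B)
    rw [hωL]
  rw [← measure_congr hae]
  exact hμ _ hBt

end Carried

/-! ### Bond configurations of `ℤ^d`: the outside σ-algebras of growing regions -/

section Lattice

variable {d : ℕ} {P : Measure (BondConfig (Site d))}

/-- The edge sets `E_{Λ_n}` of regions containing the boxes `Λ_n^{box}` swallow the lattice part of every finite set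
of pairs. [folklore] -/
theorem exists_inter_edgeSet_subset_edgesIn {Λ : ℕ → Finset (Site d)} (hbox : ∀ n, box d n ⊆ Λ n)
    (Δ : Finset (Sym2 (Site d))) :
    ∃ n, (↑Δ : Set (Sym2 (Site d))) ∩ (zdGraph d).edgeSet ⊆ ↑(edgesIn (zdGraph d) (Λ n)) := by
  refine ⟨Δ.sup pairRad, fun e he => ?_⟩
  rw [Finset.mem_coe, mem_edgesIn_iff]
  refine ⟨he.2, fun z hz => hbox _ ?_⟩
  exact mem_box_of_pairRad_le (Finset.le_sup (f := pairRad) (Finset.mem_coe.1 he.1)) z hz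

/-- The outside σ-algebras of growing regions decrease. [cite: Grimmett2006, §4.4 (the σ-fields 𝒯_Λ)] -/
theorem antitone_outsideEvents {Λ : ℕ → Finset (Site d)} (hmono : Monotone Λ) :
    Antitone fun n => outsideEvents d (Λ n) := by
  intro n k hnk
  refine cylinderEvents_mono (Set.compl_subset_compl.2 ?_)
  intro e he
  rw [Finset.mem_coe, mem_edgesIn_iff] at he ⊢
  exact ⟨he.1, fun z hz => hmono hnk (he.2 z hz)⟩

/-- **A tail-trivial measure carried by lattice configurations is `0/1`-valued on `⋂_n 𝒯_{Λ_n}`** for regions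
`Λ_n ⊇ Λ_n^{box}`: such an event lies in every `𝒯_{Λ_n} = 𝓕_{(E_{Λ_n})ᶜ}`, and the `E_{Λ_n}` swallow the lattice part
of every finite set of pairs. [cite: Grimmett2006, Prop. (4.37)(c) (proof: "if φ is tail-trivial, φ(X | 𝒯) = φ(X)")] -/
theorem measure_eq_zero_or_one_of_isTailTrivial_of_measurableSet_iInf_outsideEvents
    (hP : IsTailTrivial (V := Sym2 (Site d)) (S := Prop) P) (hlat : ∀ᵐ ω ∂P, ω ⊆ (zdGraph d).edgeSet)
    {Λ : ℕ → Finset (Site d)} (hbox : ∀ n, box d n ⊆ Λ n) {B : Set (BondConfig (Site d))}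
    (hB : MeasurableSet[⨅ n, outsideEvents d (Λ n)] B) : P B = 0 ∨ P B = 1 :=
  measure_eq_zero_or_one_of_isTailTrivial_of_ae_subset hP hlat (exists_inter_edgeSet_subset_edgesIn hbox)
    fun n => MeasurableSpace.measurableSet_iInf.1 hB n

/-- **Lévy's downward theorem along the outside σ-algebras, for a tail-trivial measure carried by lattice
configurations** (the measure-theoretic step of Grimmett 2006, Prop. (4.37)(c)): for a tail-trivial probability
measure `P` on bond configurations of `ℤ^d` with `P`-a.e. `ω ⊆ 𝔼^d`, increasing regions `Λ_n ⊇ Λ_n^{box}`, and a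
bounded integrable `f`, there is a subsequence along which `∫ |P[f | 𝒯_{Λ_n}] - P(f)| dP → 0`.
[cite: Grimmett2006, Prop. (4.37)(c)] -/
theorem exists_strictMono_tendsto_integral_abs_condExp_outsideEvents_sub_of_isTailTrivial [IsProbabilityMeasure P]
    (hP : IsTailTrivial (V := Sym2 (Site d)) (S := Prop) P) (hlat : ∀ᵐ ω ∂P, ω ⊆ (zdGraph d).edgeSet)
    {Λ : ℕ → Finset (Site d)} (hmono : Monotone Λ) (hbox : ∀ n, box d n ⊆ Λ n)
    {f : BondConfig (Site d) → ℝ} (hf : Integrable f P) {C : ℝ} (hfC : ∀ x, |f x| ≤ C) :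
    ∃ φ : ℕ → ℕ, StrictMono φ ∧
      Tendsto (fun j => ∫ x, |(P[f|outsideEvents d (Λ (φ j))]) x - ∫ y, f y ∂P| ∂P) atTop (𝓝 0) :=
  exists_strictMono_tendsto_integral_abs_condExp_sub_of_forall_measure_eq_zero_or_one
    (antitone_outsideEvents hmono) (fun n => outsideEvents_le (Λ n))
    (fun _ hB => measure_eq_zero_or_one_of_isTailTrivial_of_measurableSet_iInf_outsideEvents hP hlat hbox hB) hf hfC

end Lattice

end Summit.CriticalPhenomena.PercolationContinuityZ3.Theorems.FK

end
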